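import Summits.CriticalPhenomena.Ising3DConformalLimit.Theorems.ArmHyperscalingOneArmHyperscalingMirrorFaceDefs
import Literature.Probability.LatticeModels.IsingAutomorphismCovariance
import Literature.Probability.LatticeModels.PlusStateFKG
import Literature.Probability.LatticeModels.IsingFKG
import HarnessLib

/-!
# Reflection symmetry of the two mirror patches in the critical state
(route ArmHyperscaling, crux `OneArmHyperscaling`, item stmt-CriticalPhenomena-15591, line
`mirror-face-saturation`, Casimir variant, registered stub `patch_reflection`)

Statement (`patch_reflection`).  On `ℤ³` at `β_c(3)`, `h = 0`, with the face `E = facePatch K n`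
(the plane patch `{y₀ = n − Kn − 1, |y₁|, |y₂| ≤ Kn}`), its mirror image `A = mirrorPatch K n`
(`{y₀ = Kn + 1 − n, |y₁|, |y₂| ≤ Kn}`) in the site plane `{y₀ = 0}`, the evaluation site
`x = evalSite n = n e₀` and its mirror image `θx = −n e₀`:
(i) `⟨𝟙_{A⁺}⟩_{β_c} = ⟨𝟙_{E⁺}⟩_{β_c}`; (ii) `⟨σ_{θx} 𝟙_{A⁺}⟩_{β_c} = ⟨σ_x 𝟙_{E⁺}⟩_{β_c}`;
(iii) `⟨𝟙_{E⁺}⟩_{β_c} > 0`, where `𝟙_{B⁺} = plusIndicator B = ∏_{y ∈ B} (1 + σ_y)/2` and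
`⟨·⟩_{β_c} = critExpect = plusExpect 3 (criticalBeta 3) 0`, the `limUnder` of the plus expectations
along the centred boxes `Λ_L = box 3 L`.

Proof.  Let `θ` be the reflection `y ↦ (−y₀, y₁, y₂)` of `ℤ³`, a graph automorphism
(`zdSignedPermIso (Equiv.refl _) (−1, 1, 1)`) and an involution; it maps every centred box `Λ_L` onto
itself (`signedPerm_mem_box_iff`), `E` onto `A` and `x` onto `θx`.  By the covariance of the
finite-volume Gibbs measures under graph automorphisms (Friedli–Velenik 2017, §3.1 and Exercise 6.21;
Georgii–Higuchi 2000, §2 p. 3; tree `isingExpect_fixed_relabel` with the invariant boundary condition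
`R_θ 1 = 1`), `⟨F ∘ R_θ⟩⁺_{Λ_L} = ⟨F⟩⁺_{θ(Λ_L)} = ⟨F⟩⁺_{Λ_L}` for EVERY `L` and every measurable
observable `F`, where `(R_θ σ)(y) = σ(θ⁻¹ y) = σ(θ y)`.  Since `𝟙_{E⁺} ∘ R_θ = 𝟙_{θ(E)⁺} = 𝟙_{A⁺}` and
`σ_x ∘ R_θ = σ_{θx}`, the box sequences defining the two sides of (i), resp. (ii), coincide term by
term, hence so do their `limUnder`s (no convergence is needed).  (iii): `𝟙_{E⁺} = 2^{-|E|} Σ_{B ⊆ E} σ_B`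
(Friedli–Velenik 2017, Lemma 3.19) and the first Griffiths inequality `⟨σ_B⟩⁺_Λ ≥ 0`
(Friedli–Velenik 2017, Thm. 3.20; tree `GKSInequalities.gks_one_holds`) give `⟨𝟙_{E⁺}⟩⁺_{Λ_L} ≥ 2^{-|E|}`
once `E ⊆ Λ_L`; the box sequence converges (Friedli–Velenik 2017, Thm. 3.17 from FKG; tree
`tendsto_isingExpect_plus_plusIndicator`), so `⟨𝟙_{E⁺}⟩_{β_c} ≥ 2^{-|E|} > 0`.

References: S. Friedli, Y. Velenik, *Statistical Mechanics of Lattice Systems* (CUP 2017), §3.1,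
Exercise 6.21, Lemma 3.19, Thm. 3.17, Thm. 3.20; H.-O. Georgii, Y. Higuchi, J. Math. Phys. 41 (2000)
1153–1169, §2.  No definitions are introduced; the finite-volume lower bound is the argument of the
sibling file `ArmHyperscalingOneArmHyperscalingStubFaceLimit.lean` (private there, re-proved here).
-/

noncomputable section

namespace Summit.CriticalPhenomena.Ising3DConformalLimit.Cruxes.OneArmHyperscaling.MirrorFaceSaturation

open Literature.Probability.LatticeModels Literature.Probability.Percolation Finset Filter Topology
  MeasureTheory

section General

variable {V : Type*} [DecidableEq V] (G : SimpleGraph V) [G.LocallyFinite]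

omit [DecidableEq V] in
/-- **Relabelled increasing indicators**: `𝟙_{E⁺} ∘ R_φ = 𝟙_{φ⁻¹(E)⁺}`, since
`(R_φ σ)(y) = σ(φ⁻¹ y)` (Georgii–Higuchi 2000, §2 p. 3: the lattice transformations act canonically
on configurations and on cylinder events). -/
private theorem plusIndicator_comp_configRelabel (φ : V ≃ V) (E : Finset V) :
    plusIndicator E ∘ configRelabel φ = plusIndicator (E.map φ.symm.toEmbedding) := by
  funext σ
  rw [Function.comp_apply, plusIndicator, plusIndicator, Finset.prod_map]
  refine Finset.prod_congr rfl fun x _ => ?_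
  rw [Equiv.coe_toEmbedding, ← spinAt_apply_configRelabel φ σ (φ.symm x), Equiv.apply_symm_apply]

/-- **Covariance of plus expectations under graph automorphisms**: `⟨F⟩⁺_{φ(Λ); β, h} = ⟨F ∘ R_φ⟩⁺_{Λ; β, h}`
for measurable `F` (tree `isingExpect_fixed_relabel` with the invariant constant boundary condition
`R_φ 1 = 1`; Friedli–Velenik 2017, §3.1, Exercise 6.21). -/
private theorem isingExpect_plus_map_eq_comp (φ : G ≃g G) (Λ : Finset V) (β h : ℝ)
    {F : SpinConfig V → ℝ} (hF : Measurable F) :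
    isingExpect G (Λ.map φ.toEquiv.toEmbedding) β h .plus F =
      isingExpect G Λ β h .plus (F ∘ configRelabel φ.toEquiv) := by
  have key := isingExpect_fixed_relabel G φ Λ β h 1 hF
  have hc : configRelabel φ.toEquiv (1 : SpinConfig V) = 1 := funext fun y => by simp
  rw [hc] at key
  exact key

/-- **Friedli–Velenik 2017, Lemma 3.19, inverse direction**: `𝟙_{E⁺} = ∏_{y∈E} (1+σ_y)/2 =
2^{-|E|} Σ_{B ⊆ E} σ_B` (re-proof of the sibling FaceLimit file's private expansion). -/
private theorem plusIndicator_eq_half_pow_mul_sum (E : Finset V) (σ : SpinConfig V) :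
    plusIndicator E σ = (1 / 2 : ℝ) ^ #E * ∑ B ∈ E.powerset, spinProduct B σ := by
  have h1 : plusIndicator E σ = (∏ y ∈ E, (spinAt y σ + 1)) * ∏ _y ∈ E, (1 / 2 : ℝ) := by
    rw [plusIndicator, ← Finset.prod_mul_distrib]
    exact Finset.prod_congr rfl fun y _ => by ring
  rw [h1, Finset.prod_const, mul_comm, Finset.prod_add]
  congr 1
  refine Finset.sum_congr rfl fun B _ => ?_
  rw [Finset.prod_const_one, mul_one]
  rfl

/-- **Uniform lower bound for the conditioning event** (GKS I, Friedli–Velenik 2017, Thm. 3.20,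
eq. (3.21)): for `β, h ≥ 0` and `E ⊆ Λ`, `⟨𝟙_{E⁺}⟩⁺_{Λ;β,h} = 2^{-|E|} Σ_{B⊆E} ⟨σ_B⟩⁺_Λ ≥ 2^{-|E|}`
(the term `B = ∅` is `1`, the others are `≥ 0`; re-proof of the sibling FaceLimit file's private bound). -/
private theorem half_pow_card_le_isingExpect_plusIndicator {β h : ℝ} (hβ : 0 ≤ β) (hh : 0 ≤ h)
    {E Λ : Finset V} (hE : E ⊆ Λ) :
    (1 / 2 : ℝ) ^ #E ≤ isingExpect G Λ β h .plus (plusIndicator E) := by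
  have hexp : plusIndicator E = fun σ => (1 / 2 : ℝ) ^ #E * ∑ B ∈ E.powerset, spinProduct B σ :=
    funext (plusIndicator_eq_half_pow_mul_sum E)
  rw [hexp, isingExpect_const_mul' G Λ h _ β _
      (Finset.measurable_sum _ fun B _ => measurable_spinProduct B),
    isingExpect_finset_sum' G Λ h _ β E.powerset (fun B σ => spinProduct B σ)
      fun B => measurable_spinProduct B]
  have h0 : isingExpect G Λ β h .plus (fun σ => spinProduct (∅ : Finset V) σ) = 1 := by
    simp only [spinProduct, Finset.prod_empty]
    exact isingExpect_const G Λ β h .plus 1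
  have hrest : 0 ≤ ∑ B ∈ E.powerset.erase ∅, isingExpect G Λ β h .plus (fun σ => spinProduct B σ) :=
    Finset.sum_nonneg fun B hB => GKSInequalities.gks_one_holds G hβ hh (Or.inr rfl)
      ((Finset.mem_powerset.1 (Finset.mem_of_mem_erase hB)).trans hE)
  have hsum : 1 ≤ ∑ B ∈ E.powerset, isingExpect G Λ β h .plus (fun σ => spinProduct B σ) := by
    rw [← Finset.add_sum_erase _ _ (Finset.empty_mem_powerset E), h0]
    linarith
  calc (1 / 2 : ℝ) ^ #E = (1 / 2 : ℝ) ^ #E * 1 := (mul_one _).symm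
    _ ≤ (1 / 2 : ℝ) ^ #E * ∑ B ∈ E.powerset, isingExpect G Λ β h .plus (fun σ => spinProduct B σ) :=
      mul_le_mul_of_nonneg_left hsum (by positivity)

end General

/-! ### On `ℤ^d`: positivity of `⟨𝟙_{E⁺}⟩⁺` -/

section Zd

variable {d : ℕ}

/-- **The plus state gives positive mass to `{σ ≡ +1 on E}`**: `⟨𝟙_{E⁺}⟩⁺_{β,h} ≥ 2^{-|E|}` for
`β, h ≥ 0` (GKS I in the boxes containing `E`, Friedli–Velenik 2017, Thm. 3.20, and the box limit of
Friedli–Velenik 2017, Thm. 3.17, tree `tendsto_isingExpect_plus_plusIndicator`). -/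
private theorem half_pow_card_le_plusExpect_plusIndicator {β h : ℝ} (hβ : 0 ≤ β) (hh : 0 ≤ h)
    (E : Finset (Site d)) : (1 / 2 : ℝ) ^ #E ≤ plusExpect d β h (plusIndicator E) := by
  refine ge_of_tendsto (tendsto_isingExpect_plus_plusIndicator
    (fun _ => ising_fkg_holds (zdGraph d)) hβ h E) ?_
  obtain ⟨L₀, hL₀⟩ := exists_forall_subset_box d E
  exact eventually_atTop.2 ⟨L₀, fun L hL =>
    half_pow_card_le_isingExpect_plusIndicator (zdGraph d) hβ hh (hL₀ L hL)⟩

end Zd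

/-! ### The reflection `θ : y ↦ (−y₀, y₁, y₂)` of `ℤ³` -/

/-- Membership in a coordinate-box `piFinset` of `ℤ³`, coordinate by coordinate. -/
private theorem mem_piFinset_fin3' {S : Fin 3 → Finset ℤ} {y : Site 3} :
    y ∈ Fintype.piFinset S ↔ y 0 ∈ S 0 ∧ y 1 ∈ S 1 ∧ y 2 ∈ S 2 := by
  rw [Fintype.mem_piFinset, Fin.forall_fin_succ, Fin.forall_fin_two]
  rfl

/-- The reflection `θ` exchanges the two patches: `θ y ∈ facePatch K n ↔ y ∈ mirrorPatch K n`
(first coordinates `−y₀ = n − Kn − 1 ↔ y₀ = Kn + 1 − n`, the other two unchanged). -/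
private theorem reflect_mem_facePatch_iff (K n : ℕ) (y : Site 3) :
    Site.signedPerm (Equiv.refl (Fin 3)) ![-1, 1, 1] y ∈ facePatch K n ↔ y ∈ mirrorPatch K n := by
  simp only [facePatch, mirrorPatch, mem_piFinset_fin3']
  simp [Finset.mem_Icc]
  omega

/-- `θ⁻¹(facePatch K n) = mirrorPatch K n` as finite sets (θ is an involution). -/
private theorem facePatch_map_reflect_symm (K n : ℕ) :
    (facePatch K n).map (zdSignedPermIso (Equiv.refl (Fin 3)) ![-1, 1, 1]).toEquiv.symm.toEmbedding =
      mirrorPatch K n := by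
  ext y
  rw [Finset.mem_map_equiv, Equiv.symm_symm]
  exact reflect_mem_facePatch_iff K n y

/-- `θ` maps every centred box `Λ_L` onto itself (`signedPerm_mem_box_iff`). -/
private theorem box_map_reflect (L : ℕ) :
    (box 3 L).map (zdSignedPermIso (Equiv.refl (Fin 3)) ![-1, 1, 1]).toEquiv.toEmbedding = box 3 L := by
  ext y
  rw [Finset.mem_map_equiv]
  change (Site.signedPerm _ _).symm y ∈ box 3 L ↔ _
  rw [Site.signedPerm_symm, signedPerm_mem_box_iff]

/-- `θ (−n e₀) = n e₀ = evalSite n`. -/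
private theorem reflect_neg_evalSite (n : ℕ) :
    (zdSignedPermIso (Equiv.refl (Fin 3)) ![-1, 1, 1]).toEquiv (Pi.single 0 (-(n : ℤ))) =
      evalSite n := by
  funext j
  change Site.signedPerm _ _ _ j = _
  fin_cases j <;> simp [evalSite]

/-- `𝟙_{E⁺} ∘ R_θ = 𝟙_{A⁺}` for `E = facePatch K n`, `A = mirrorPatch K n = θ(E)`. -/
private theorem plusIndicator_facePatch_comp_reflect (K n : ℕ) :
    plusIndicator (facePatch K n) ∘
        configRelabel (zdSignedPermIso (Equiv.refl (Fin 3)) ![-1, 1, 1]).toEquiv =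
      plusIndicator (mirrorPatch K n) := by
  rw [plusIndicator_comp_configRelabel, facePatch_map_reflect_symm]

/-- `(σ_x 𝟙_{E⁺}) ∘ R_θ = σ_{θx} 𝟙_{A⁺}` with `x = evalSite n = n e₀`, `θx = −n e₀`. -/
private theorem spinFace_comp_reflect (K n : ℕ) :
    (fun σ => spinAt (evalSite n) σ * plusIndicator (facePatch K n) σ) ∘
        configRelabel (zdSignedPermIso (Equiv.refl (Fin 3)) ![-1, 1, 1]).toEquiv =
      fun σ => spinAt (Pi.single 0 (-(n : ℤ))) σ * plusIndicator (mirrorPatch K n) σ := by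
  funext σ
  rw [Function.comp_apply]
  congr 1
  · rw [← reflect_neg_evalSite n, spinAt_apply_configRelabel]
  · exact congrFun (plusIndicator_facePatch_comp_reflect K n) σ

/-- **Termwise reflection invariance along the centred boxes**: `⟨F ∘ R_θ⟩⁺_{Λ_L} = ⟨F⟩⁺_{Λ_L}` for
every `L` and measurable `F` (`θ(Λ_L) = Λ_L` and covariance, Friedli–Velenik 2017, §3.1, Exercise 6.21). -/
private theorem isingExpect_box_plus_comp_reflect (L : ℕ) (β h : ℝ)
    {F : SpinConfig (Site 3) → ℝ} (hF : Measurable F) :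
    isingExpect (zdGraph 3) (box 3 L) β h .plus
        (F ∘ configRelabel (zdSignedPermIso (Equiv.refl (Fin 3)) ![-1, 1, 1]).toEquiv) =
      isingExpect (zdGraph 3) (box 3 L) β h .plus F := by
  rw [← isingExpect_plus_map_eq_comp (zdGraph 3) (zdSignedPermIso (Equiv.refl (Fin 3)) ![-1, 1, 1])
    (box 3 L) β h hF, box_map_reflect]

/-- **Reflection invariance of the critical state on the observables at hand**:
`critExpect (F ∘ R_θ) = critExpect F` for measurable `F`, because the two defining box sequences
coincide term by term (so their `limUnder`s agree, convergent or not). -/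
private theorem critExpect_comp_reflect {F : SpinConfig (Site 3) → ℝ} (hF : Measurable F) :
    critExpect (F ∘ configRelabel (zdSignedPermIso (Equiv.refl (Fin 3)) ![-1, 1, 1]).toEquiv) =
      critExpect F := by
  rw [critExpect, critExpect, plusExpect, plusExpect]
  congr 1
  funext L
  exact isingExpect_box_plus_comp_reflect L _ _ hF

/-! ### The registered stub -/

/-- **Reflection symmetry of the mirror patches** (registered stub `patch_reflection` of the Casimir
variant of line `mirror-face-saturation`, crux `OneArmHyperscaling`, item stmt-CriticalPhenomena-15591):
with `E = facePatch K n`, `A = mirrorPatch K n`, `x = evalSite n`, `θx = −n e₀`, in the critical state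
`critExpect` of the Ising model on `ℤ³`:
(i) `⟨𝟙_{A⁺}⟩ = ⟨𝟙_{E⁺}⟩`, (ii) `⟨σ_{θx} 𝟙_{A⁺}⟩ = ⟨σ_x 𝟙_{E⁺}⟩`, (iii) `0 < ⟨𝟙_{E⁺}⟩`.
(i), (ii): covariance of the finite-volume plus measures under the reflection `θ` of `ℤ³`, which
preserves the centred boxes (Friedli–Velenik 2017, §3.1, Exercise 6.21; Georgii–Higuchi 2000, §2), so
the defining box sequences agree term by term; (iii): GKS I lower bound `⟨𝟙_{E⁺}⟩⁺_{Λ_L} ≥ 2^{-|E|}`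
(Friedli–Velenik 2017, Lemma 3.19, Thm. 3.20) and the box limit (Thm. 3.17). -/
theorem patch_reflection : ∀ K n : ℕ, critExpect (plusIndicator (mirrorPatch K n)) = critExpect (plusIndicator (facePatch K n)) ∧ critExpect (fun σ => spinAt (Pi.single 0 (-(n : ℤ))) σ * plusIndicator (mirrorPatch K n) σ) = critExpect (fun σ => spinAt (evalSite n) σ * plusIndicator (facePatch K n) σ) ∧ 0 < critExpect (plusIndicator (facePatch K n)) := by
  intro K n
  refine ⟨?_, ?_, ?_⟩
  · have h := critExpect_comp_reflect (measurable_plusIndicator (facePatch K n))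
    rw [plusIndicator_facePatch_comp_reflect K n] at h
    exact h
  · have h := critExpect_comp_reflect
      (F := fun σ => spinAt (evalSite n) σ * plusIndicator (facePatch K n) σ)
      ((measurable_spinAt (evalSite n)).mul (measurable_plusIndicator (facePatch K n)))
    rw [spinFace_comp_reflect K n] at h
    exact h
  · change 0 < plusExpect 3 (criticalBeta 3) 0 (plusIndicator (facePatch K n))
    exact lt_of_lt_of_le (by positivity)
      (half_pow_card_le_plusExpect_plusIndicator (criticalBeta_nonneg 3) le_rfl (facePatch K n))

end Summit.CriticalPhenomena.Ising3DConformalLimit.Cruxes.OneArmHyperscaling.MirrorFaceSaturation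

end
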